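import Summits.AtomisticToContinuum.HydrodynamicLimit.Theorems.RelayRaceLocalityConeLocalisationBubbleHypDefs
import Summits.AtomisticToContinuum.HydrodynamicLimit.Theorems.RelayRaceLocalityConeLocalisationBubbleReadouts
import Summits.AtomisticToContinuum.HydrodynamicLimit.Theorems.RelayRaceLocalityConeLocalisationBubbleReadoutsSobolev
import HarnessLib

/-!
# RelayRaceLocality · ConeLocalisation — bubble stub: the read-out input `ReadoutHyp` discharged

Lead-held stub `stub_bubble : BubbleAtScale` of line `Sketch`, crux `stmt-AtomisticToContinuum-12504`; lead
prover-line-stmt-AtomisticToContinuum-12504-0 (2026-08-17). The typed input `Bubble.ReadoutHyp` of the bubble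
assembly (`…BubbleHypDefs.lean`) follows from the landed read-out files (worker w-readouts): the σ-uniform drift
bounds `hsEuler_timeDeriv_drift_bounds` (`…BubbleReadouts.lean`, p135120; its drift clause (T2) has weaker hypotheses
than `ReadoutHyp` asks — open time slab, no temperature floor) and the derivative-only Sobolev read-out
`partialDeriv_sq_le_derivEnergies` (`…BubbleReadoutsSobolev.lean`, p135153; its right-hand sides are `fieldD3`,
`fieldD3V` by `unfold`).
-/

noncomputable section

namespace Summit.AtomisticToContinuum.HydrodynamicLimit.Theorems.ConeLocalisation.Bubble

open Set
open Literature.MathematicalPhysics.KineticTheory Literature.Analysis.FluidPDE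
  Literature.Analysis.FunctionSpaces

/-- **The read-out input of the bubble assembly holds** (drift bounds from the primitive equations + derivative-only
Sobolev read-out, from the landed read-out files). [folklore] -/
theorem readoutHyp_holds : ReadoutHyp := by
  refine ⟨?_, ?_⟩
  · obtain ⟨ηT, hηT, H⟩ := hsEuler_timeDeriv_drift_bounds
    refine ⟨ηT, hηT, fun M hM => ?_⟩
    obtain ⟨CT, hCT, HC⟩ := H M hM
    refine ⟨CT, hCT, fun σ hσ T ρ θ u hE t ht A _hA h x => ?_⟩
    refine (HC σ T ρ θ u hσ hE).2 t ht A (fun s hs y => ?_) x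
    obtain ⟨g1, g2, -, g4, g5, g6, g7⟩ := h s ⟨hs.1, hs.2.le⟩ y
    exact ⟨g6, g1, g2, g4, g5, g7⟩
  · obtain ⟨KS, hKS, H1, H2⟩ := partialDeriv_sq_le_derivEnergies
    refine ⟨KS, hKS, fun f hf x l => ?_, fun w hw x l => ?_⟩
    · unfold fieldD3
      exact H1 f hf l x
    · unfold fieldD3V
      exact H2 w hw l x

end Summit.AtomisticToContinuum.HydrodynamicLimit.Theorems.ConeLocalisation.Bubble

end
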